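import Literature.Computability.AlgebraicComplexity.DIP20MultiplicityObstructions
import Literature.RepresentationTheory.GeneralLinear.PlethysmWordModel
import Literature.RepresentationTheory.FiniteGroups.SymmetricGroupFrobeniusFormula
import Literature.Computability.Complexity.OccurrenceObstructionsBIP
import HarnessLib

/-!
# Dörfler–Ikenmeyer–Panova 2020, eq. (4.4), discharged: plethysm coefficients are alternating sums of
# monomial counts, `a_λ(d[n]) = Σ_{π ∈ S_ℓ} sgn(π) c_{λ+π-id}(d,n)`

Topic `Literature/Computability/AlgebraicComplexity` (val-lit cell, DAG row DIP20-A; discharge of the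
named fact `DIP20_eq_4_4` of `DIP20MultiplicityObstructions.lean`). Source: J. Dörfler, C. Ikenmeyer,
G. Panova, *On geometric complexity theory: Multiplicity obstructions are stronger than occurrence
obstructions*, SIAM J. Appl. Algebra Geom. 4 (2020) = arXiv:1901.04576, §4, eq. (4.3)–(4.4) (arXiv
p. 9): "`c_ν(d,n) := (x^ν) @ h_d[h_n] = ⟨h_ν, h_d[h_n]⟩ = #{(b) : …}`" and "by Jacobi–Trudi
`a_λ(d[n]) = ⟨det[h_{λ_i-i+j}], h_d[h_n]⟩ = Σ_{π ∈ S_{ℓ(λ)}} sgn(π) c_{λ+π-(1,2,…)}(d,n)`".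

## The proof formalised here (word model + Frobenius + Burnside; no symmetric functions)

The printed derivation is two lines of symmetric-function theory (the character of `Sym^d Sym^n`,
Schur/Jacobi–Trudi and duality of the Hall inner product). The tree has no plethysm of symmetric
functions; instead everything needed is already PROVED in the word model of `V^{⊗dn}`:

* `a_λ(d[n]) = dim wreathHW k N 1 λ`, the `S_d ≀ S_n`-invariant highest-weight vectors of weight `λ`
  in `(k^N)^{⊗dn}` (`plethysmCoeffOfPartition_eq_finrank_wreathHW`, `PlethysmWordModel.lean`);
* the character formula `|S_d ≀ S_n| · dim wreathHW 1 λ = Σ_{τ ∈ S_d ≀ S_n} χ^λ(τ)`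
  (`card_mul_finrank_wreathHW`, `WreathHighestWeight.lean`; Schur–Weyl `character_hwPermRep`);
* Frobenius's formula in permutation-module form
  `χ^λ(σ) = Σ_{π ∈ S_N} sgn(π) · #{w : [dn] → [N] | w ∘ σ = w, cont(w) = λ + ρ - ρ∘π⁻¹}`
  (`spechtCharacter_eq_sum_sign_mul_card`, `SymmetricGroupFrobeniusFormula.lean`).

Summing Frobenius over the wreath product and exchanging the sums leaves, for each `π`, the
Burnside count `Σ_{τ ∈ S_d ≀ S_n} #{w : cont(w) = c, w ∘ τ = w} = |S_d ≀ S_n| · #(orbits)` for the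
wreath product acting on the words of a fixed content `c`; §1–§2 of this file identify the orbits
with the multisets of the `d` block contents (weak `N`-compositions of `n`) of sum `c`, i.e. with the
objects counted by DIP's `c_c(d,n)` = `dipMonomialCount c d n` (`blockContents_eq_iff`,
`exists_blockContents_eq`, `sum_card_fixed_eq_card_mul_dipMonomialCount`; orbit–stabilizer by finite
sums, as in `SymmetricGroupFrobeniusOrthogonality.lean`). Cancelling `|S_d ≀ S_n|` gives the partition
form `plethysmCoeffOfPartition_eq_sum_sign_dipMonomialCount` (any `N ≥ ℓ(λ)`), and the printed
row-vector form `DIP20_eq_4_4_holds` follows with `ρ_j - ρ_{π j} = π j - j` (`partitionOfRows`).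

Consequence (not developed here): every plethysm coefficient `a_λ(d[n])` of the DIP20 / BIP facts is
now a signed sum of at most `ℓ(λ)!` elementary monomial counts `c_ν(d,n)`, which is the route to
kernel evaluations of the printed LiE values (Prop. 3.15's table, Prop. 3.2, Thm. 3.5 instances).

HONEST FRAMING. Classical representation theory of `GL_N` / `S_{dn}` (Frobenius 1900, Gay 1976) in a
toy-model computation; nothing here bears on permanent versus determinant; VP ≠ VNP is not proved
and nothing in this file is progress on it. No new named facts; the three `def`s are counting
plumbing (block contents, stabiliser order).

## References

* [DorflerIkenmeyerPanova2020] §4, eq. (4.3)–(4.4) (arXiv p. 9; TeX multobs.tex L585–L589).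
* [BurgisserIkenmeyerPanovaJAMS2019] P. Bürgisser, C. Ikenmeyer, G. Panova, J. AMS 32 (2019), §4,
  (4.1): `Sym^d Sym^n V = (V^{⊗dn})^{S_d ≀ S_n}`, the wreath product acting on positions in blocks.
* [FultonHarrisGTM129] W. Fulton, J. Harris, *Representation Theory*, GTM 129, (4.41) (Frobenius's
  formula as an alternating sum of permutation characters), (2.9).

## Tree

`Word`, `wordContent`, `wordContent_comp_perm`, `exists_comp_perm_eq_of_wordContent_eq`,
`exists_perm_comp_eq_of_card_fiber_eq` (`TensorWordModel`, `SchurWeylHighestWeightProofs`);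
`blockPerms`, `blockPermsFinset`, `outerBlockPerm`, `innerBlockPerm` (`PlethysmStability`);
`blockMapFun`, `innerFun`, `apply_finProdFinEquiv_of_mem`, `wreathHW`, `card_mul_finrank_wreathHW`
(`WreathHighestWeight`); `plethysmCoeffOfPartition_eq_finrank_wreathHW` (`PlethysmWordModel`);
`spechtCharacter_eq_sum_sign_mul_card`, `exists_word_of_content` (`SymmetricGroupFrobeniusFormula`,
`…Orthogonality`); `rho`, `rho_apply` (`SchurPolynomials`); `partitionOfRows` (`OccurrenceObstructionsBIP`);
`dipMonomialCount`, `rowDual_sortedParts`, `DIP20_eq_4_4` (`DIP20MultiplicityObstructions`).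
-/

noncomputable section

open scoped BigOperators
open Finset

namespace Literature.Computability.AlgebraicComplexity

open _root_.Literature.NumberTheory.DiophantineGeometry
open _root_.Literature.RepresentationTheory.GeneralLinear
open _root_.Literature.RepresentationTheory.FiniteGroups
open _root_.Literature.RingTheory.SymmetricFunctions.SymmPoly (rho rho_apply)

/-! ### §1. Block contents of a word on `d` blocks of `n` positions -/

section BlockContents

variable {N d n : ℕ}

/-- The content (letter multiplicities) of block `r` of a word on `d` blocks of `n` positions
(positions `finProdFinEquiv (r, p)`, as in `blockPerms d n`). [folklore] -/
def blockContent (w : Word N (d * n)) (r : Fin d) : Fin N → ℕ :=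
  fun i => (univ.filter fun p : Fin n => w (finProdFinEquiv (r, p)) = i).card

/-- The multiset of the `d` block contents of a word. [folklore] -/
def blockContents (w : Word N (d * n)) : Multiset (Fin N → ℕ) :=
  (univ : Finset (Fin d)).val.map (blockContent w)

/-- The content of block `r` is the content of the word `p ↦ w (r, p)`. [folklore] -/
private theorem blockContent_eq_wordContent (w : Word N (d * n)) (r : Fin d) :
    blockContent w r = wordContent (fun p : Fin n => w (finProdFinEquiv (r, p))) := by
  funext i
  rfl

/-- A block content sums to the block size `n`. [folklore] -/
private theorem sum_blockContent (w : Word N (d * n)) (r : Fin d) : ∑ i, blockContent w r i = n := by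
  rw [blockContent_eq_wordContent, sum_wordContent]

/-- `blockContents w` has `d` elements. [folklore] -/
private theorem card_blockContents (w : Word N (d * n)) : Multiset.card (blockContents w) = d := by
  rw [blockContents, Multiset.card_map, Finset.card_val, Finset.card_univ, Fintype.card_fin]

/-- Every member of `blockContents w` sums to `n`. [folklore] -/
private theorem sum_eq_of_mem_blockContents (w : Word N (d * n)) {α : Fin N → ℕ}
    (hα : α ∈ blockContents w) : ∑ i, α i = n := by
  obtain ⟨r, -, rfl⟩ := Multiset.mem_map.mp hα
  exact sum_blockContent w r

/-- The block contents add up to the content of the word (the positions are the disjoint union of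
the blocks). [cite: BurgisserIkenmeyerPanovaJAMS2019, §4 (positions in blocks)] -/
theorem sum_blockContents (w : Word N (d * n)) :
    (blockContents w).sum = fun i => wordContent w i := by
  rw [blockContents, ← Finset.sum_eq_multiset_sum]
  funext i
  rw [Finset.sum_apply]
  simp only [blockContent, wordContent]
  rw [← Finset.card_sigma]
  refine Finset.card_bij (fun rp _ => finProdFinEquiv (rp.1, rp.2)) ?_ ?_ ?_
  · rintro ⟨r, p⟩ h
    simp only [Finset.mem_sigma, Finset.mem_filter, Finset.mem_univ, true_and] at h
    simpa using h
  · rintro ⟨r, p⟩ _ ⟨r', p'⟩ _ h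
    have := finProdFinEquiv.injective h
    simp only [Prod.mk.injEq] at this
    obtain ⟨rfl, rfl⟩ := this
    rfl
  · intro q hq
    refine ⟨⟨(finProdFinEquiv.symm q).1, (finProdFinEquiv.symm q).2⟩, ?_, ?_⟩
    · simp only [Finset.mem_sigma, Finset.mem_filter, Finset.mem_univ, true_and, Prod.mk.eta,
        Equiv.apply_symm_apply]
      simpa using hq
    · exact finProdFinEquiv.apply_symm_apply q

variable [NeZero n]

/-- A wreath-product element carries the content of block `r` of `w ∘ τ` to the content of block
`blockMapFun τ r` of `w` (inside the block it only permutes the places).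
[cite: BurgisserIkenmeyerPanovaJAMS2019, §4 (the wreath product S_d ≀ S_n)] -/
theorem blockContent_comp_of_mem {τ : Equiv.Perm (Fin (d * n))} (hτ : τ ∈ blockPerms d n)
    (w : Word N (d * n)) (r : Fin d) :
    blockContent (w ∘ ⇑τ) r = blockContent w (blockMapFun τ r) := by
  funext i
  simp only [blockContent, Function.comp_apply]
  refine Finset.card_equiv (Equiv.ofBijective (innerFun τ r)
    (Finite.injective_iff_bijective.mp (innerFun_injective hτ r))) fun p => ?_
  simp only [Finset.mem_filter, Finset.mem_univ, true_and, Equiv.ofBijective_apply]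
  rw [apply_finProdFinEquiv_of_mem hτ]

/-- **The multiset of block contents is an invariant of the wreath-product action.**
[cite: BurgisserIkenmeyerPanovaJAMS2019, §4 (the wreath product S_d ≀ S_n)] -/
theorem blockContents_comp_of_mem {τ : Equiv.Perm (Fin (d * n))} (hτ : τ ∈ blockPerms d n)
    (w : Word N (d * n)) : blockContents (w ∘ ⇑τ) = blockContents w := by
  unfold blockContents
  have hfun : blockContent (w ∘ ⇑τ) = blockContent w ∘ blockMapFun τ :=
    funext fun r => blockContent_comp_of_mem hτ w r
  rw [hfun, ← Multiset.map_map]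
  congr 1
  set e : Fin d ≃ Fin d := Equiv.ofBijective (blockMapFun τ)
    (Finite.injective_iff_bijective.mp (blockMapFun_injective hτ))
  have : Multiset.map (blockMapFun τ) (univ : Finset (Fin d)).val = (univ.map e.toEmbedding).val := by
    rw [Finset.map_val]
    rfl
  rw [this, Finset.map_univ_equiv]

omit [NeZero n] in
/-- **Words with the same multiset of block contents lie in one wreath-product orbit** (permute the
blocks to align the contents, then the places inside each block).
[cite: BurgisserIkenmeyerPanovaJAMS2019, §4 (the wreath product S_d ≀ S_n)] -/
theorem exists_mem_blockPerms_comp_eq {w w' : Word N (d * n)} (h : blockContents w = blockContents w') :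
    ∃ τ ∈ blockPerms d n, w ∘ ⇑τ = w' := by
  classical
  -- a permutation of the blocks matching the contents
  have key : ∀ (v : Word N (d * n)) (a : Fin N → ℕ),
      (univ.filter fun r => blockContent v r = a).card = Multiset.count a (blockContents v) := by
    intro v a
    rw [blockContents, Multiset.count_map, ← Finset.filter_val, Finset.card_val]
    congr 1
    exact Finset.filter_congr fun r _ => eq_comm
  have hfib : ∀ a, (univ.filter fun r => blockContent w r = a).card =
      (univ.filter fun r => blockContent w' r = a).card := by
    intro a
    rw [key, key, h]
  obtain ⟨π, hπ⟩ := exists_perm_comp_eq_of_card_fiber_eq (blockContent w) (blockContent w') hfib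
  -- inside each block, a permutation matching the words
  have hinner : ∀ r : Fin d, ∃ e : Equiv.Perm (Fin n),
      (fun p : Fin n => w (finProdFinEquiv (π r, p))) ∘ ⇑e = fun p => w' (finProdFinEquiv (r, p)) := by
    intro r
    apply exists_comp_perm_eq_of_wordContent_eq
    intro a
    have := congrFun (hπ r) a
    rw [blockContent_eq_wordContent, blockContent_eq_wordContent] at this
    exact this
  choose e he using hinner
  refine ⟨outerBlockPerm d n π * innerBlockPerm d n e,
    (blockPerms d n).mul_mem (outerBlockPerm_mem_blockPerms π) (innerBlockPerm_mem_blockPerms e), ?_⟩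
  funext q
  obtain ⟨⟨r, p⟩, rfl⟩ := finProdFinEquiv.surjective q
  have := congrFun (he r) p
  simp only [Function.comp_apply] at this
  rw [Function.comp_apply, Equiv.Perm.mul_apply, innerBlockPerm_apply, outerBlockPerm_apply, this]

omit [NeZero n] in
/-- Conversely, words in one wreath-product orbit have the same block contents; so the fibres of
`blockContents` are exactly the orbits — the monomials of `Sym^d Sym^n V` (BIP (4.1)).
[cite: BurgisserIkenmeyerPanovaJAMS2019, §4 eq. (4.1)] -/
theorem blockContents_eq_iff [NeZero n] (w w' : Word N (d * n)) :
    blockContents w = blockContents w' ↔ ∃ τ ∈ blockPerms d n, w ∘ ⇑τ = w' := by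
  refine ⟨exists_mem_blockPerms_comp_eq, ?_⟩
  rintro ⟨τ, hτ, rfl⟩
  exact (blockContents_comp_of_mem hτ w).symm

omit [NeZero n] in
/-- **Every multiset of `d` content vectors of sum `n` is the multiset of block contents of a word**
(so the orbits are in bijection with the objects counted by DIP's `c_ν(d,n)`).
[cite: DorflerIkenmeyerPanova2020, eq. (4.3) (arXiv p. 9)] -/
theorem exists_blockContents_eq (M : Multiset (Fin N → ℕ)) (hcard : Multiset.card M = d)
    (hsum : ∀ α ∈ M, ∑ i, α i = n) : ∃ w : Word N (d * n), blockContents w = M := by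
  classical
  -- enumerate `M` by `Fin d`
  obtain ⟨f, hf⟩ : ∃ f : Fin d → (Fin N → ℕ), (univ : Finset (Fin d)).val.map f = M := by
    induction M using Quotient.inductionOn with
    | h l =>
      have hl : l.length = d := by simpa using hcard
      subst hl
      exact ⟨l.get, by rw [Fin.univ_val_map, List.ofFn_get]; rfl⟩
  -- a word of the prescribed content in each block
  have hw : ∀ r : Fin d, ∃ u : Fin n → Fin N, ∀ a, (univ.filter fun p => u p = a).card = f r a := by
    intro r
    apply exists_word_of_content
    rw [Fintype.card_fin]
    exact hsum (f r) (by rw [← hf]; exact Multiset.mem_map_of_mem _ (Finset.mem_univ r))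
  choose u hu using hw
  refine ⟨fun q => u (finProdFinEquiv.symm q).1 (finProdFinEquiv.symm q).2, ?_⟩
  rw [← hf, blockContents]
  congr 1
  funext r a
  simp only [blockContent, Equiv.symm_apply_apply]
  exact hu r a

end BlockContents

/-! ### §2. Orbit–stabilizer and Burnside for the wreath product acting on words -/

section Burnside

variable {N d n : ℕ}

/-- The number of elements of the wreath product fixing a word (order of the stabiliser).
[folklore] -/
def stabCount (d n : ℕ) (w : Word N (d * n)) : ℕ :=
  ((blockPermsFinset d n).filter fun τ : Equiv.Perm (Fin (d * n)) => w ∘ ⇑τ = w).card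

/-- The stabiliser order is positive (the identity fixes every word). [folklore] -/
private theorem stabCount_pos (w : Word N (d * n)) : 0 < stabCount d n w :=
  Finset.card_pos.mpr ⟨1, Finset.mem_filter.mpr ⟨one_mem_blockPermsFinset, by simp⟩⟩

/-- Conjugate points of an orbit have stabilisers of the same order. [folklore] -/
private theorem stabCount_comp_of_mem {g : Equiv.Perm (Fin (d * n))} (hg : g ∈ blockPerms d n)
    (w : Word N (d * n)) : stabCount d n (w ∘ ⇑g) = stabCount d n w := by
  unfold stabCount
  refine Finset.card_equiv (MulAut.conj g).toEquiv fun τ => ?_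
  simp only [Finset.mem_filter, mem_blockPermsFinset, MulEquiv.toEquiv_eq_coe, MulEquiv.coe_toEquiv,
    MulAut.conj_apply]
  constructor
  · rintro ⟨hτ, h⟩
    refine ⟨(blockPerms d n).mul_mem ((blockPerms d n).mul_mem hg hτ) ((blockPerms d n).inv_mem hg), ?_⟩
    funext p
    have := congr_fun h (g⁻¹ p)
    simpa using this
  · rintro ⟨hτ, h⟩
    refine ⟨?_, ?_⟩
    · have := (blockPerms d n).mul_mem ((blockPerms d n).mul_mem ((blockPerms d n).inv_mem hg) hτ) hg
      simpa [mul_assoc] using this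
    · funext p
      have := congr_fun h (g p)
      simpa using this

/-- The image of `blockContents` on the words of content `c` is the set of multisets counted by
`dipMonomialCount c d n`. [cite: DorflerIkenmeyerPanova2020, eq. (4.3) (arXiv p. 9)] -/
theorem mem_image_blockContents_iff (c : Fin N → ℕ) (M : Multiset (Fin N → ℕ)) :
    M ∈ (univ.filter fun w : Word N (d * n) => (fun i => wordContent w i) = c).image blockContents ↔
      Multiset.card M = d ∧ (∀ α ∈ M, ∑ i, α i = n) ∧ M.sum = c := by
  constructor
  · intro hM
    obtain ⟨w, hw, rfl⟩ := Finset.mem_image.mp hM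
    exact ⟨card_blockContents w, fun α hα => sum_eq_of_mem_blockContents w hα,
      (sum_blockContents w).trans (Finset.mem_filter.mp hw).2⟩
  · rintro ⟨hcard, hsum, hc⟩
    obtain ⟨w, hw⟩ := exists_blockContents_eq M hcard hsum
    refine Finset.mem_image.mpr ⟨w, Finset.mem_filter.mpr ⟨Finset.mem_univ _, ?_⟩, hw⟩
    rw [← sum_blockContents, hw, hc]

/-- `dipMonomialCount c d n` counts the image of `blockContents` on the words of content `c`.
[cite: DorflerIkenmeyerPanova2020, eq. (4.3) (arXiv p. 9)] -/
theorem dipMonomialCount_eq_card_image (c : Fin N → ℕ) :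
    dipMonomialCount c d n =
      ((univ.filter fun w : Word N (d * n) => (fun i => wordContent w i) = c).image blockContents).card := by
  set S := (univ.filter fun w : Word N (d * n) => (fun i => wordContent w i) = c).image blockContents
  unfold dipMonomialCount
  rw [Nat.card_congr (Equiv.subtypeEquivRight (fun M => (mem_image_blockContents_iff c M).symm) :
      {M : Multiset (Fin N → ℕ) // Multiset.card M = d ∧ (∀ α ∈ M, ∑ i, α i = n) ∧ M.sum = c} ≃
        {M // M ∈ S}),
    Nat.card_eq_fintype_card, Fintype.card_coe]

variable [NeZero n]

/-- The translates `w₀ ∘ g`, `g ∈ S_d ≀ S_n`, sweep the orbit (= the fibre of `blockContents`), each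
point being hit `stabCount w₀` times. [folklore] -/
private theorem sum_blockPermsFinset_comp_eq_smul {M : Type*} [AddCommMonoid M] (w₀ : Word N (d * n))
    (f : Word N (d * n) → M) :
    ∑ g ∈ blockPermsFinset d n, f (w₀ ∘ ⇑g) =
      stabCount d n w₀ • ∑ w ∈ univ.filter (fun w => blockContents w = blockContents w₀), f w := by
  classical
  set T := univ.filter (fun w : Word N (d * n) => blockContents w = blockContents w₀) with hT
  have hmaps : ∀ g ∈ blockPermsFinset d n, w₀ ∘ ⇑g ∈ T := fun g hg =>
    Finset.mem_filter.mpr ⟨Finset.mem_univ _, blockContents_comp_of_mem (mem_blockPermsFinset.mp hg) w₀⟩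
  rw [← Finset.sum_fiberwise_of_maps_to hmaps, Finset.smul_sum]
  refine Finset.sum_congr rfl fun w hw => ?_
  obtain ⟨g₀, hg₀, hg₀w⟩ := exists_mem_blockPerms_comp_eq ((Finset.mem_filter.mp hw).2).symm
  have hfib : ∀ g ∈ (blockPermsFinset d n).filter (fun g : Equiv.Perm (Fin (d * n)) => w₀ ∘ ⇑g = w),
      f (w₀ ∘ ⇑g) = f w := by
    intro g hg
    rw [(Finset.mem_filter.mp hg).2]
  rw [Finset.sum_congr rfl hfib, Finset.sum_const]
  congr 1
  refine Finset.card_equiv (Equiv.mulRight g₀⁻¹) fun g => ?_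
  simp only [Finset.mem_filter, mem_blockPermsFinset, Equiv.coe_mulRight]
  constructor
  · rintro ⟨hg, h⟩
    refine ⟨(blockPerms d n).mul_mem hg ((blockPerms d n).inv_mem hg₀), ?_⟩
    funext p
    have h1 : w₀ (g (g₀⁻¹ p)) = w (g₀⁻¹ p) := congr_fun h (g₀⁻¹ p)
    have h2 : w₀ (g₀ (g₀⁻¹ p)) = w (g₀⁻¹ p) := congr_fun hg₀w (g₀⁻¹ p)
    have h3 : g₀ (g₀⁻¹ p) = p := Equiv.apply_symm_apply g₀ p
    rw [h3] at h2
    simp only [Function.comp_apply, Equiv.Perm.coe_mul, h1, ← h2]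
  · rintro ⟨hg, h⟩
    refine ⟨?_, ?_⟩
    · have := (blockPerms d n).mul_mem hg hg₀
      simpa using this
    · funext p
      have h1 := congr_fun h (g₀ p)
      have h2 : w₀ (g₀ p) = w p := congr_fun hg₀w p
      have h3 : g₀⁻¹ (g₀ p) = p := Equiv.symm_apply_apply g₀ p
      simp only [Function.comp_apply, Equiv.Perm.coe_mul, h3] at h1
      rw [Function.comp_apply, h1, h2]

/-- **Orbit–stabilizer for the wreath product**: over one orbit (a fibre of `blockContents`) the
stabiliser orders add up to `|S_d ≀ S_n|`. [folklore] -/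
private theorem sum_stabCount_fibre (w₀ : Word N (d * n)) :
    ∑ w ∈ univ.filter (fun w => blockContents w = blockContents w₀), stabCount d n w =
      (blockPermsFinset d n).card := by
  have h := sum_blockPermsFinset_comp_eq_smul w₀ (stabCount d n)
  have hconst : ∀ g ∈ blockPermsFinset d n, stabCount d n (w₀ ∘ ⇑g) = stabCount d n w₀ :=
    fun g hg => stabCount_comp_of_mem (mem_blockPermsFinset.mp hg) w₀
  rw [Finset.sum_congr rfl hconst, Finset.sum_const, smul_eq_mul, smul_eq_mul, mul_comm] at h
  exact (Nat.eq_of_mul_eq_mul_left (stabCount_pos w₀) h).symm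

/-- **Burnside's count for the wreath product on words of a given content**:
`∑_{τ ∈ S_d ≀ S_n} #{w : cont w = c, w ∘ τ = w} = |S_d ≀ S_n| · c_c(d,n)`, the orbits of
`S_d ≀ S_n` on the words of content `c` being the multisets of `d` block contents of sum `c`.
[cite: DorflerIkenmeyerPanova2020, eq. (4.3) (arXiv p. 9)] -/
theorem sum_card_fixed_eq_card_mul_dipMonomialCount (c : Fin N → ℕ) :
    ∑ τ ∈ blockPermsFinset d n,
        (univ.filter fun w : Word N (d * n) => w ∘ ⇑τ = w ∧ (fun i => wordContent w i) = c).card =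
      (blockPermsFinset d n).card * dipMonomialCount c d n := by
  classical
  -- exchange the summations
  have hx : ∑ τ ∈ blockPermsFinset d n,
      (univ.filter fun w : Word N (d * n) => w ∘ ⇑τ = w ∧ (fun i => wordContent w i) = c).card =
      ∑ w ∈ univ.filter (fun w : Word N (d * n) => (fun i => wordContent w i) = c), stabCount d n w := by
    rw [Finset.sum_filter]
    simp only [stabCount, Finset.card_filter]
    rw [Finset.sum_comm]
    refine Finset.sum_congr rfl fun w _ => ?_
    by_cases hc : (fun i => wordContent w i) = c
    · simp only [hc, and_true, if_true]
    · simp only [hc, and_false, if_false, Finset.sum_const_zero]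
  rw [hx, dipMonomialCount_eq_card_image]
  set W := univ.filter (fun w : Word N (d * n) => (fun i => wordContent w i) = c)
  rw [← Finset.sum_fiberwise_of_maps_to (g := blockContents) (t := W.image blockContents)
    fun w hw => Finset.mem_image_of_mem _ hw]
  rw [Finset.card_eq_sum_ones (W.image blockContents), Finset.mul_sum]
  refine Finset.sum_congr rfl fun M hM => ?_
  obtain ⟨w₀, hw₀, rfl⟩ := Finset.mem_image.mp hM
  rw [mul_one, ← sum_stabCount_fibre w₀]
  refine Finset.sum_congr ?_ fun _ _ => rfl
  ext w
  simp only [Finset.mem_filter, Finset.mem_univ, true_and, W, and_iff_right_iff_imp]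
  intro hw
  rw [← sum_blockContents, hw, sum_blockContents]
  exact (Finset.mem_filter.mp hw₀).2

end Burnside

/-! ### §3. Frobenius assembly: `a_λ(d[n])` as an alternating sum of monomial counts -/

section Assembly

variable {N d n : ℕ}

/-- The order of the wreath product, in the two bookkeepings of the tree. [folklore] -/
private theorem natCard_blockPerms_eq_card (d n : ℕ) :
    Nat.card ↥(blockPerms d n) = (blockPermsFinset d n).card := by
  rw [Nat.card_congr (Equiv.subtypeEquivRight (fun τ => (mem_blockPermsFinset (D := d) (m := n)).symm) :
      {τ // τ ∈ blockPerms d n} ≃ {τ // τ ∈ blockPermsFinset d n}),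
    Nat.card_eq_fintype_card, Fintype.card_coe]

/-- The fixed-word count of Frobenius's formula for one `π ∈ S_N`, summed over the wreath product:
`|S_d ≀ S_n| · c_{λ+ρ-ρ∘π}(d,n)` when `λ + ρ - ρ∘π ≥ 0`, else `0`. [folklore] -/
private theorem sum_card_fixed_rho (lamv : Fin N → ℕ) (π : Equiv.Perm (Fin N)) [NeZero n] :
    ∑ τ ∈ blockPermsFinset d n, (univ.filter fun w : Word N (d * n) =>
        w ∘ ⇑τ = w ∧ ∀ j, rho N (π j) + wordContent w j = lamv j + rho N j).card =
      if ∀ j, rho N (π j) ≤ lamv j + rho N j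
      then (blockPermsFinset d n).card *
        dipMonomialCount (fun j => lamv j + rho N j - rho N (π j)) d n
      else 0 := by
  classical
  split_ifs with hfeas
  · rw [← sum_card_fixed_eq_card_mul_dipMonomialCount]
    refine Finset.sum_congr rfl fun τ _ => ?_
    congr 1
    refine Finset.filter_congr fun w _ => ?_
    refine and_congr_right fun _ => ?_
    rw [funext_iff]
    refine forall_congr' fun j => ?_
    have := hfeas j
    omega
  · simp only [not_forall, not_le] at hfeas
    obtain ⟨j, hj⟩ := hfeas
    refine Finset.sum_eq_zero fun τ _ => ?_
    rw [Finset.card_eq_zero, Finset.filter_eq_empty_iff]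
    intro w _ h
    have := h.2 j
    omega

/-- **`a_λ(d[n])` is an alternating sum of monomial counts** (partition form, over `ℂ`): for
`λ ⊢ d·n` with at most `N` parts and `n ≥ 1`,
`a_λ(d[n]) = Σ_{π ∈ S_N} sgn(π) · c_{λ+ρ-ρ∘π}(d,n)` (terms with a negative entry being `0`), where
`c_ν(d,n)` counts the multisets of `d` weak `N`-compositions of `n` with sum `ν`
(`dipMonomialCount`). Proof: `|H|·a_λ = Σ_{τ ∈ H} χ^λ(τ)`, `H = S_d ≀ S_n`
(`card_mul_finrank_wreathHW`), Frobenius's formula in permutation-module form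
(`spechtCharacter_eq_sum_sign_mul_card`) and Burnside for `H` on the words of each content
(`sum_card_fixed_eq_card_mul_dipMonomialCount`). [cite: DorflerIkenmeyerPanova2020, eq. (4.4) (arXiv p. 9)] -/
theorem plethysmCoeffOfPartition_eq_sum_sign_dipMonomialCount_complex (hn : 0 < n)
    (lam : Nat.Partition (d * n)) (hN : lam.parts.card ≤ N) :
    (plethysmCoeffOfPartition ℂ N n lam : ℂ) =
      ∑ π : Equiv.Perm (Fin N), ((Equiv.Perm.sign π : ℤ) : ℂ) *
        (if ∀ j, rho N (π j) ≤ lam.sortedParts.getD j 0 + rho N j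
          then (dipMonomialCount
            (fun j => lam.sortedParts.getD j 0 + rho N j - rho N (π j)) d n : ℂ)
          else 0) := by
  classical
  haveI : NeZero n := ⟨hn.ne'⟩
  set lamv : Fin N → ℕ := fun j => lam.sortedParts.getD j 0 with hlamv
  -- `|H| · a_λ = Σ_{τ ∈ H} χ^λ(τ)`
  have h1 := card_mul_finrank_wreathHW ℂ N (1 : ↥(blockPerms d n) →* ℤˣ) lam hN
  rw [← plethysmCoeffOfPartition_eq_finrank_wreathHW ℂ N hn.ne' lam hN] at h1
  simp only [MonoidHom.one_apply, Units.val_one, Int.cast_one, one_mul] at h1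
  -- Frobenius, then exchange of summations
  have h2 : ∑ τ : ↥(blockPerms d n), spechtCharacter ℂ lam (τ : Equiv.Perm (Fin (d * n))) =
      ∑ π : Equiv.Perm (Fin N), ((Equiv.Perm.sign π : ℤ) : ℂ) *
        ∑ τ ∈ blockPermsFinset d n, ((univ.filter fun w : Word N (d * n) =>
          w ∘ ⇑τ = w ∧ ∀ j, rho N (π⁻¹ j) + wordContent w j = lamv j + rho N j).card : ℂ) := by
    rw [← Finset.sum_subtype (blockPermsFinset d n) (fun τ => mem_blockPermsFinset)
      (fun τ : Equiv.Perm (Fin (d * n)) => spechtCharacter ℂ lam τ)]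
    simp_rw [spechtCharacter_eq_sum_sign_mul_card lam hN, Finset.mul_sum]
    rw [Finset.sum_comm]
  -- reindex `π ↦ π⁻¹`
  have h3 : ∑ π : Equiv.Perm (Fin N), ((Equiv.Perm.sign π : ℤ) : ℂ) *
        ∑ τ ∈ blockPermsFinset d n, ((univ.filter fun w : Word N (d * n) =>
          w ∘ ⇑τ = w ∧ ∀ j, rho N (π⁻¹ j) + wordContent w j = lamv j + rho N j).card : ℂ) =
      ∑ π : Equiv.Perm (Fin N), ((Equiv.Perm.sign π : ℤ) : ℂ) *
        ∑ τ ∈ blockPermsFinset d n, ((univ.filter fun w : Word N (d * n) =>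
          w ∘ ⇑τ = w ∧ ∀ j, rho N (π j) + wordContent w j = lamv j + rho N j).card : ℂ) := by
    rw [← Equiv.sum_comp (Equiv.inv (Equiv.Perm (Fin N)))]
    refine Finset.sum_congr rfl fun π _ => ?_
    simp only [Equiv.inv_apply, Equiv.Perm.sign_inv, inv_inv]
  -- Burnside, contentwise
  have h4 : ∀ π : Equiv.Perm (Fin N),
      (∑ τ ∈ blockPermsFinset d n, ((univ.filter fun w : Word N (d * n) =>
          w ∘ ⇑τ = w ∧ ∀ j, rho N (π j) + wordContent w j = lamv j + rho N j).card : ℂ)) =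
        ((blockPermsFinset d n).card : ℂ) *
          (if ∀ j, rho N (π j) ≤ lamv j + rho N j
            then (dipMonomialCount (fun j => lamv j + rho N j - rho N (π j)) d n : ℂ) else 0) := by
    intro π
    have h := sum_card_fixed_rho (d := d) (n := n) lamv π
    rw [← Nat.cast_sum, h]
    split_ifs <;> push_cast <;> ring
  rw [h2, h3] at h1
  simp_rw [h4] at h1
  -- cancel `|H|`
  have hcard : ((blockPermsFinset d n).card : ℂ) ≠ 0 :=
    Nat.cast_ne_zero.mpr (card_blockPermsFinset_pos (D := d) (m := n)).ne'
  rw [natCard_blockPerms_eq_card] at h1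
  have h5 : ((blockPermsFinset d n).card : ℂ) * (plethysmCoeffOfPartition ℂ N n lam : ℂ) =
      ((blockPermsFinset d n).card : ℂ) * ∑ π : Equiv.Perm (Fin N), ((Equiv.Perm.sign π : ℤ) : ℂ) *
        (if ∀ j, rho N (π j) ≤ lamv j + rho N j
          then (dipMonomialCount (fun j => lamv j + rho N j - rho N (π j)) d n : ℂ) else 0) := by
    rw [h1, Finset.mul_sum]
    refine Finset.sum_congr rfl fun π _ => ?_
    ring
  exact mul_left_cancel₀ hcard h5

/-- **`a_λ(d[n])` as an alternating sum of monomial counts** (partition form, over `ℤ`).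
[cite: DorflerIkenmeyerPanova2020, eq. (4.4) (arXiv p. 9)] -/
theorem plethysmCoeffOfPartition_eq_sum_sign_dipMonomialCount (hn : 0 < n)
    (lam : Nat.Partition (d * n)) (hN : lam.parts.card ≤ N) :
    (plethysmCoeffOfPartition ℂ N n lam : ℤ) =
      ∑ π : Equiv.Perm (Fin N), (Equiv.Perm.sign π : ℤ) *
        (if ∀ j, rho N (π j) ≤ lam.sortedParts.getD j 0 + rho N j
          then (dipMonomialCount
            (fun j => lam.sortedParts.getD j 0 + rho N j - rho N (π j)) d n : ℤ)
          else 0) := by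
  have h := plethysmCoeffOfPartition_eq_sum_sign_dipMonomialCount_complex hn lam hN
  have hcast : ∀ π : Equiv.Perm (Fin N),
      (((if ∀ j, rho N (π j) ≤ lam.sortedParts.getD j 0 + rho N j
          then (dipMonomialCount (fun j => lam.sortedParts.getD j 0 + rho N j - rho N (π j)) d n : ℤ)
          else 0) : ℤ) : ℂ) =
        (if ∀ j, rho N (π j) ≤ lam.sortedParts.getD j 0 + rho N j
          then (dipMonomialCount (fun j => lam.sortedParts.getD j 0 + rho N j - rho N (π j)) d n : ℂ)
          else 0) := by
    intro π
    split_ifs <;> simp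
  simp_rw [← hcast, ← Int.cast_mul, ← Int.cast_sum] at h
  exact_mod_cast h

end Assembly

/-! ### §4. Dörfler–Ikenmeyer–Panova (4.4) as printed (row vectors) -/

section RowForm

open _root_.Literature.Computability.Complexity (partitionOfRows getD_sortedParts_partitionOfRows
  card_parts_partitionOfRows_le)

/-- **Dörfler–Ikenmeyer–Panova 2020, eq. (4.4), DISCHARGED** (arXiv p. 9; TeX multobs.tex L589
`eq:pleth_det`): "`a_λ(d[n]) = ⟨det[h_{λ_i - i + j}], h_d[h_n]⟩ = Σ_{π ∈ S_{ℓ(λ)}} sgn(π) c_{λ+π-(1,2,…)}(d,n)`",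
as typed (`DIP20_eq_4_4`: `a_λ(d[n]) = plethysmCoeff ℂ (Fin ℓ) n (rowDual λ)` for an antitone row vector
`λ` of size `d·n`, `n ≥ 1`, `0`-indexed `π`, terms with a negative entry of `λ + π - id` being `0`).
Proof: the partition form `plethysmCoeffOfPartition_eq_sum_sign_dipMonomialCount` (word model of the
plethysm, Frobenius's formula, Burnside for `S_d ≀ S_n`) at the partition with rows `λ`
(`partitionOfRows`), with `ρ_j - ρ_{π j} = π j - j`. [cite: DorflerIkenmeyerPanova2020, eq. (4.4) (arXiv p. 9)] -/
theorem DIP20_eq_4_4_holds : DIP20_eq_4_4 := by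
  intro ℓ n d lam hn hanti hsum
  classical
  -- the partition with rows `lam`
  set w : ℕ → ℕ := fun i => if h : i < ℓ then lam ⟨i, h⟩ else 0 with hw
  have hwfin : ∀ i : Fin ℓ, w i = lam i := fun i => by
    simp only [hw, dif_pos i.2]
  have hwanti : Antitone w := by
    intro i j hij
    by_cases hj : j < ℓ
    · have hi : i < ℓ := lt_of_le_of_lt hij hj
      rw [show w j = lam ⟨j, hj⟩ from hwfin ⟨j, hj⟩, show w i = lam ⟨i, hi⟩ from hwfin ⟨i, hi⟩]
      exact hanti (Fin.mk_le_mk.mpr hij)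
    · have : w j = 0 := by simp only [hw, dif_neg hj]
      rw [this]
      exact Nat.zero_le _
  have hwsum : ∑ r ∈ Finset.range ℓ, w r = d * n := by
    rw [Finset.sum_range, ← hsum]
    exact Finset.sum_congr rfl fun i _ => hwfin i
  have hget : ∀ i : Fin ℓ, (partitionOfRows w ℓ (d * n)).sortedParts.getD i 0 = lam i := by
    intro i
    rw [getD_sortedParts_partitionOfRows hwanti hwsum, if_pos i.2, hwfin]
  have hcard : (partitionOfRows w ℓ (d * n)).parts.card ≤ ℓ :=
    card_parts_partitionOfRows_le hwanti hwsum
  have hrow : rowDual lam = Weight.dualOfPartition ℓ (partitionOfRows w ℓ (d * n)) := by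
    rw [← rowDual_sortedParts]
    congr 1
    funext i
    exact (hget i).symm
  rw [hrow]
  change (plethysmCoeffOfPartition ℂ ℓ n (partitionOfRows w ℓ (d * n)) : ℤ) = _
  rw [plethysmCoeffOfPartition_eq_sum_sign_dipMonomialCount hn _ hcard]
  refine Finset.sum_congr rfl fun π _ => ?_
  congr 1
  have hfeas : (∀ j : Fin ℓ, rho ℓ (π j) ≤ (partitionOfRows w ℓ (d * n)).sortedParts.getD j 0 + rho ℓ j) ↔
      ∀ i : Fin ℓ, (i : ℕ) ≤ lam i + (π i : ℕ) := by
    refine forall_congr' fun j => ?_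
    rw [hget, rho_apply, rho_apply]
    have := j.2
    have := (π j).2
    omega
  have hcont : (fun j : Fin ℓ => (partitionOfRows w ℓ (d * n)).sortedParts.getD j 0 + rho ℓ j - rho ℓ (π j)) =
      fun i : Fin ℓ => lam i + (π i : ℕ) - (i : ℕ) := by
    funext j
    rw [hget, rho_apply, rho_apply]
    have := j.2
    have := (π j).2
    omega
  rw [hcont]
  exact if_congr hfeas rfl rfl

end RowForm

end Literature.Computability.AlgebraicComplexity
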